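import Literature.Analysis.FluidPDE.CKNMorreyDualEstimate
import Literature.Analysis.FluidPDE.CKNMorreyHolder
import HarnessLib

/-!
# Set-up lemmas for the localised Duhamel representation of Lemma 13.6

Analysis/FluidPDE support file (everything proved, no definitions) in the decomposition of the
named fact `Literature.Analysis.FluidPDE.LemarieRieusset2016.lemma13_6_duhamel`
(`CKNMorreyHolder.lean`: Lemarié-Rieusset 2016, §13.9 Step 3 and Lemma 13.6, pp. 474–478):

* `exists_product_cutoff_spatial` — the product cut-off `φ(t, x) = χ(t)ω(x)` of
  `CKNMorreyDualEstimate.exists_product_cutoff` with, in addition to flatness on the inner box,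
  the vanishing of **all spatial derivatives on the whole inner ball** `B(x₀, ρ₁)` at every time
  (the terms of the duality identity carrying `∇φ`, `Δφ`, `D²φ` are supported in the spatial
  annulus `ρ₁ ≤ ‖x - x₀‖ ≤ ρ₂`, hence spatially separated from the inner cylinder);
* `parabolicHolderOnWith_one_of_contDiffOn` — a function `C¹` on a neighbourhood of the closed
  box `[t₀ - r², t₀ + r²] × B̄(x₀, r)` is Lipschitz for the parabolic distance on `Q_r(t₀, x₀)`
  (mean value inequality on the convex box, and `|t - s| ≤ √|t - s| · √2 r` there);
* `setIntegral_coeff_mul_eq_integral_modification` — `∫_Ω T m X = ∫ (T m̃) X` for a continuous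
  coefficient `T` supported in a compact `K ⊆ Ω` and a modification `m̃ = m` a.e. on `Ω`.

## References

* P. G. Lemarié-Rieusset, *The Navier–Stokes Problem in the 21st Century*, CRC Press (2016),
  §13.9 p. 474 (the cut-off), Lemma 13.6 pp. 477–478. [LemarieRieusset2016]
-/

noncomputable section

open MeasureTheory Set Function Filter Metric Real ContinuousLinearMap TopologicalSpace
open scoped ENNReal NNReal Topology RealInnerProductSpace Laplacian

namespace Literature.Analysis.FluidPDE

/-! ### The product cut-off with spatial flatness on the inner ball -/

/-- **Product cut-off, spatial form.** For `0 < ρ₁ < ρ₂` and a centre `z₀ = (t₀, x₀)` there is a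
space–time test function `φ = χ ⊗ ω` with `0 ≤ φ ≤ 1`, `tsupport φ ⊆ [t₀-ρ₂², t₀+ρ₂²] × B̄(x₀, ρ₂)`,
`φ = 1` on the open box `{|t - t₀| < ρ₁²} × B(x₀, ρ₁)`, and whose spatial derivatives of orders
one and two (hence `∇φ`, `Δφ`) vanish at **every** `(t, x)` with `‖x - x₀‖ < ρ₁`. [folklore] -/
theorem exists_product_cutoff_spatial (z₀ : ℝ × EuclideanSpace ℝ (Fin 3)) {ρ₁ ρ₂ : ℝ} (hρ₁ : 0 < ρ₁)
    (hρ₁₂ : ρ₁ < ρ₂) :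
    ∃ φ : ℝ → EuclideanSpace ℝ (Fin 3) → ℝ,
      IsSpaceTimeTestOn (⊤ : Opens (ℝ × EuclideanSpace ℝ (Fin 3))) φ ∧
      (∀ t x, 0 ≤ φ t x ∧ φ t x ≤ 1) ∧
      tsupport (uncurry φ) ⊆ closedBall z₀.1 (ρ₂ ^ 2) ×ˢ closedBall z₀.2 ρ₂ ∧
      (∀ z : ℝ × EuclideanSpace ℝ (Fin 3), |z.1 - z₀.1| < ρ₁ ^ 2 → dist z.2 z₀.2 < ρ₁ → φ z.1 z.2 = 1) ∧
      ∀ (t : ℝ) (x : EuclideanSpace ℝ (Fin 3)), dist x z₀.2 < ρ₁ →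
        fderiv ℝ (φ t) x = 0 ∧ (Δ (φ t)) x = 0 ∧
          ∀ v w : EuclideanSpace ℝ (Fin 3), fderiv ℝ (fun y => fderiv ℝ (φ t) y v) x w = 0 := by
  have hρ₂ : 0 < ρ₂ := hρ₁.trans hρ₁₂
  have hsq : ρ₁ ^ 2 < ρ₂ ^ 2 := by nlinarith
  let χ : ContDiffBump z₀.1 := ⟨ρ₁ ^ 2, ρ₂ ^ 2, by positivity, hsq⟩
  let ω : ContDiffBump z₀.2 := ⟨ρ₁, ρ₂, hρ₁, hρ₁₂⟩
  have hsupp : tsupport (uncurry fun t x => χ t * ω x) ⊆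
      closedBall z₀.1 (ρ₂ ^ 2) ×ˢ closedBall z₀.2 ρ₂ := by
    refine closure_minimal (fun z hz => ?_) (isClosed_closedBall.prod isClosed_closedBall)
    have hz' : χ z.1 ≠ 0 ∧ ω z.2 ≠ 0 := mul_ne_zero_iff.1 hz
    have h1 : z.1 ∈ Function.support χ := hz'.1
    have h2 : z.2 ∈ Function.support ω := hz'.2
    rw [χ.support_eq] at h1
    rw [ω.support_eq] at h2
    exact ⟨ball_subset_closedBall h1, ball_subset_closedBall h2⟩
  refine ⟨fun t x => χ t * ω x, ?_, ?_, hsupp, ?_, ?_⟩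
  · refine ⟨?_, ?_, fun _ _ => trivial⟩
    · exact (χ.contDiff.comp contDiff_fst).mul (ω.contDiff.comp contDiff_snd)
    · exact HasCompactSupport.intro' ((isCompact_closedBall _ _).prod (isCompact_closedBall _ _))
        (isClosed_closedBall.prod isClosed_closedBall)
        (fun z hz => image_eq_zero_of_notMem_tsupport (fun h => hz (hsupp h)))
  · intro t x
    exact ⟨mul_nonneg χ.nonneg ω.nonneg, mul_le_one₀ χ.le_one ω.nonneg ω.le_one⟩
  · rintro ⟨s, y⟩ hs hy
    simp only at hs hy ⊢
    have hs' : s ∈ ball z₀.1 χ.rIn := by rw [mem_ball, Real.dist_eq]; exact hs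
    have hy' : y ∈ ball z₀.2 ω.rIn := hy
    rw [χ.one_of_mem_closedBall (ball_subset_closedBall hs'),
      ω.one_of_mem_closedBall (ball_subset_closedBall hy'), mul_one]
  · intro s y hy
    have hy' : y ∈ ball z₀.2 ω.rIn := hy
    -- first derivatives vanish on the whole inner ball
    have hfd : ∀ x ∈ ball z₀.2 ω.rIn, fderiv ℝ (fun x' => χ s * ω x') x = 0 := by
      intro x hx
      have hsl : (fun x' => χ s * ω x') =ᶠ[𝓝 x] fun _ => χ s := by
        filter_upwards [ω.eventuallyEq_one_of_mem_ball hx] with x' hx'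
        rw [hx', Pi.one_apply, mul_one]
      rw [hsl.fderiv_eq]; simp
    have hfd0 : fderiv ℝ (fun x' => χ s * ω x') y = 0 := hfd y hy'
    have hfd2 : ∀ v w : EuclideanSpace ℝ (Fin 3),
        fderiv ℝ (fun x => fderiv ℝ (fun x' => χ s * ω x') x v) y w = 0 := by
      intro v w
      have hev : (fun x => fderiv ℝ (fun x' => χ s * ω x') x v) =ᶠ[𝓝 y] fun _ => (0 : ℝ) := by
        filter_upwards [isOpen_ball.mem_nhds hy'] with x hx
        rw [hfd x hx]; rfl
      rw [hev.fderiv_eq]; simp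
    refine ⟨hfd0, ?_, hfd2⟩
    have h2 : ContDiff ℝ 2 (fun x' => χ s * ω x') := contDiff_const.mul ω.contDiff
    rw [laplacian_eq_sum_fderiv_fderiv_normed (EuclideanSpace.basisFun (Fin 3) ℝ) h2 y]
    exact Finset.sum_eq_zero fun i _ => hfd2 _ _

/-! ### Parabolic Lipschitz continuity of smooth functions on a cylinder -/

/-- On the cylinder `Q_r(z₀)` the Euclidean (sup) distance is dominated by the parabolic one:
`‖z₁ - z₂‖ ≤ max 1 (√2 r) · δ₂(z₁, z₂)`. [folklore] -/
theorem norm_sub_le_mul_parabolicDist {r : ℝ} (hr : 0 < r) {z₀ z₁ z₂ : ℝ × EuclideanSpace ℝ (Fin 3)}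
    (h₁ : z₁ ∈ FluidPDE.parabolicCylinderCentered r z₀) (h₂ : z₂ ∈ FluidPDE.parabolicCylinderCentered r z₀) :
    ‖z₁ - z₂‖ ≤ max 1 (Real.sqrt 2 * r) * parabolicDist z₁ z₂ := by
  rw [FluidPDE.mem_parabolicCylinderCentered] at h₁ h₂
  have ht : |z₁.1 - z₂.1| ≤ 2 * r ^ 2 := by
    rw [abs_le]; constructor <;> linarith [h₁.1.1, h₁.1.2, h₂.1.1, h₂.1.2]
  have hM : 1 ≤ max 1 (Real.sqrt 2 * r) := le_max_left _ _
  have hsqrt : |z₁.1 - z₂.1| ≤ Real.sqrt 2 * r * Real.sqrt |z₁.1 - z₂.1| := by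
    have h0 : 0 ≤ |z₁.1 - z₂.1| := abs_nonneg _
    have h1 : Real.sqrt |z₁.1 - z₂.1| ≤ Real.sqrt 2 * r := by
      rw [show Real.sqrt 2 * r = Real.sqrt (2 * r ^ 2) by
        rw [Real.sqrt_mul (by norm_num), Real.sqrt_sq hr.le]]
      exact Real.sqrt_le_sqrt ht
    calc |z₁.1 - z₂.1| = Real.sqrt |z₁.1 - z₂.1| * Real.sqrt |z₁.1 - z₂.1| :=
          (Real.mul_self_sqrt h0).symm
      _ ≤ Real.sqrt 2 * r * Real.sqrt |z₁.1 - z₂.1| := by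
          gcongr
  rw [Prod.norm_def]
  refine max_le ?_ ?_
  · calc ‖(z₁ - z₂).1‖ = |z₁.1 - z₂.1| := by simp [Real.norm_eq_abs]
      _ ≤ Real.sqrt 2 * r * Real.sqrt |z₁.1 - z₂.1| := hsqrt
      _ ≤ max 1 (Real.sqrt 2 * r) * Real.sqrt |z₁.1 - z₂.1| := by
          gcongr
          exact le_max_right _ _
      _ ≤ max 1 (Real.sqrt 2 * r) * parabolicDist z₁ z₂ := by
          gcongr
          rw [parabolicDist]; linarith [norm_nonneg (z₁.2 - z₂.2)]
  · calc ‖(z₁ - z₂).2‖ = ‖z₁.2 - z₂.2‖ := by simp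
      _ ≤ 1 * parabolicDist z₁ z₂ := by
          rw [one_mul, parabolicDist]; linarith [Real.sqrt_nonneg (|z₁.1 - z₂.1|)]
      _ ≤ max 1 (Real.sqrt 2 * r) * parabolicDist z₁ z₂ := by
          gcongr
          · exact parabolicDist_nonneg _ _

/-- **A function `C¹` on a neighbourhood of the closed box `[t₀-r², t₀+r²] × B̄(x₀, r)` is
Lipschitz for the parabolic distance on `Q_r(t₀, x₀)`** (mean value inequality on the convex box
with the bound of the derivative on the compact box, and `norm_sub_le_mul_parabolicDist`). [folklore] -/
theorem parabolicHolderOnWith_one_of_contDiffOn {R : ℝ × EuclideanSpace ℝ (Fin 3) → ℝ}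
    {U : Set (ℝ × EuclideanSpace ℝ (Fin 3))} (hU : IsOpen U) (hR : ContDiffOn ℝ 1 R U) {r : ℝ}
    (hr : 0 < r) {z₀ : ℝ × EuclideanSpace ℝ (Fin 3)}
    (hKU : Icc (z₀.1 - r ^ 2) (z₀.1 + r ^ 2) ×ˢ closedBall z₀.2 r ⊆ U) :
    ∃ L : ℝ, ParabolicHolderOnWith L 1 R (FluidPDE.parabolicCylinderCentered r z₀) := by
  set K : Set (ℝ × EuclideanSpace ℝ (Fin 3)) := Icc (z₀.1 - r ^ 2) (z₀.1 + r ^ 2) ×ˢ closedBall z₀.2 r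
    with hK
  have hKc : IsCompact K := isCompact_Icc.prod (isCompact_closedBall _ _)
  have hKconv : Convex ℝ K := (convex_Icc _ _).prod (convex_closedBall _ _)
  -- the derivative is continuous on `U`, hence bounded on `K`
  have hcont : ContinuousOn (fun z => fderiv ℝ R z) U := hR.continuousOn_fderiv_of_isOpen hU le_rfl
  obtain ⟨C, hC⟩ := hKc.exists_bound_of_continuousOn (hcont.mono hKU)
  have hC0 : 0 ≤ C := (norm_nonneg _).trans (hC (z₀.1, z₀.2) ⟨⟨by nlinarith, by nlinarith⟩,
    mem_closedBall_self hr.le⟩)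
  have hdiff : ∀ z ∈ K, DifferentiableAt ℝ R z := fun z hz =>
    (hR.differentiableOn one_ne_zero z (hKU hz)).differentiableAt (hU.mem_nhds (hKU hz))
  have hlip : LipschitzOnWith ⟨C, hC0⟩ R K :=
    hKconv.lipschitzOnWith_of_nnnorm_fderiv_le (fun z hz => hdiff z hz)
      (fun z hz => by
        show ‖fderiv ℝ R z‖₊ ≤ ⟨C, hC0⟩
        exact_mod_cast hC z hz)
  have hQK : FluidPDE.parabolicCylinderCentered r z₀ ⊆ K := by
    intro z hz
    rw [FluidPDE.mem_parabolicCylinderCentered] at hz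
    exact ⟨⟨hz.1.1.le, hz.1.2.le⟩, mem_closedBall.2 hz.2.le⟩
  refine ⟨C * max 1 (Real.sqrt 2 * r), fun z₁ h₁ z₂ h₂ => ?_⟩
  rw [Real.rpow_one]
  calc ‖R z₁ - R z₂‖ ≤ C * ‖z₁ - z₂‖ := by
        have h := hlip.norm_sub_le (hQK h₁) (hQK h₂)
        exact h
    _ ≤ C * (max 1 (Real.sqrt 2 * r) * parabolicDist z₁ z₂) := by
        gcongr
        exact norm_sub_le_mul_parabolicDist hr h₁ h₂
    _ = C * max 1 (Real.sqrt 2 * r) * parabolicDist z₁ z₂ := by ring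

/-! ### Passing from the data to their measurable modifications -/

/-- **`∫_Ω T m X = ∫ (T m̃) X`** for a continuous coefficient `T` vanishing off a set `K ⊆ Ω` and
a modification `m̃ = m` a.e. on `Ω`. [folklore] -/
theorem setIntegral_coeff_mul_eq_integral_modification {Ω : Set (ℝ × EuclideanSpace ℝ (Fin 3))}
    (hΩ : MeasurableSet Ω) {K : Set (ℝ × EuclideanSpace ℝ (Fin 3))} (hKΩ : K ⊆ Ω)
    {T m m' X : ℝ × EuclideanSpace ℝ (Fin 3) → ℝ} (hT0 : ∀ z, z ∉ K → T z = 0)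
    (hmm' : ∀ᵐ z ∂(volume.restrict Ω), m z = m' z) :
    ∫ z in Ω, T z * m z * X z = ∫ z, (T z * m' z) * X z := by
  have h1 : ∫ z in Ω, T z * m z * X z = ∫ z in Ω, T z * m' z * X z := by
    refine setIntegral_congr_ae hΩ ?_
    have h := (ae_restrict_iff' hΩ).1 hmm'
    filter_upwards [h] with z hz hzΩ
    rw [hz hzΩ]
  rw [h1]
  refine setIntegral_eq_integral_of_forall_compl_eq_zero fun z hz => ?_
  rw [hT0 z (fun h => hz (hKΩ h))]
  ring

end Literature.Analysis.FluidPDE
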